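import Mathlib
import Summits.QuantumFields.YangMills.Theorems.BalabanUVNodesK2NamedJetsRunRemAt

/-!
# Idea-5 g18 — FROZEN-DOMAIN SCHWARZ BAND (crux idea on stmt-QuantumFields-20543, aimed at the deciding crux
stmt-QuantumFields-27364 `StabilityBRunRowsAtRecordR13SepCoPHV`, rows (i)+(iv) along in-window runs).

HONEST FRAMING.  Nothing of Bałaban is asserted or proved here; [Balaban1987RG1] Thm 2 / (0.31) p.259 are UNPROVED in
print; route R4 closes ONLY the conditional finite-𝕋⁴ rung `BalabanLadder.UV`; the Yang–Mills mass gap (Clay) is NOT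
proved by any of this.  Every `def … : Prop` below is a HYPOTHESIS SHAPE; every theorem is kernel bookkeeping
(Schwarz's lemma from Mathlib + real arithmetic).

THE LEVER.  In the (2.13) step integral ([I] p.268) the running coupling `g_k` plays TWO roles: (a) the radius `ε/g_k` of
the small-field domain of the SCALED fluctuation variable `B = B′/g_k` ((2.9) p.266 is coupling-blind in `B′`), and (b) the
vertex strength: every term of the exponent contains `g_k` only through `g_k·CB` inside print's analytic functions and the
exponent VANISHES at `g_k = 0` (p.268).  FREEZE (a) at the run's value and COMPLEXIFY (b): `z ↦ Φ_k(z)`.  The Gaussian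
measure `dμ_{C^{(k)}}(B)` and `χ_k` are `z`-free (positive measure), Gaussian domination of the cubic-and-higher vertices
holds while `|z|·(ε/g_k) ≤ c_dom`, so `Φ_k` is analytic on the disc `|z| < ρ_k := c_dom·g_k/ε` and the PHYSICAL point
`z = g_k` sits at relative depth `q = ε/c_dom < 1` — THE SAME NUMBER FOR EVERY SCALE `k` AND EVERY RUN, because
`ρ_k · q = g_k` is forced by `R_k · g_k = ε`.  Schwarz's lemma then gives the BAND
`|β_{k+1}(run prefix) − b_k| ≤ M·q + η = M·ε/c_dom + (small-field mass term)`, k- and history-uniform, with no modulus,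
no derivative, no cumulant and no polymer-level statement; rows (i)+(iv) of K1⁹ consume exactly such a band once it lies
below the one-loop floor (`θ.ε₂₉`, `θ.γ` are existential in K1⁹'s conclusion).
-/

namespace Summit.QuantumFields.YangMills.Cruxes.EndpointGivenBR13SepCoPH.Idea5g18FrozenSchwarz

open Literature.MathematicalPhysics.QuantumFieldTheory.Balaban1983to89
open Literature.MathematicalPhysics.QuantumFieldTheory.Balaban1983to89.FlowStep
open Summit.QuantumFields.YangMills.Theorems.BalabanUVNodesK2NamedJetsRunRemAt (RunConstRemainder)
open Metric Set Finset
open scoped BigOperators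

noncomputable section

/-! ## §1 The Schwarz band (pure function theory, Mathlib `Complex.dist_le_div_mul_dist_of_mapsTo_ball`) -/

/-- **SCHWARZ BAND.**  `Φ` analytic on the disc `|z| < ρ`, oscillating by `≤ M` from its centre value there; a real point
`g ≥ 0` at RELATIVE DEPTH `g ≤ q·ρ`, `q < 1`.  Then `‖Φ g − Φ 0‖ ≤ M·q` — the radius `ρ` has CANCELLED: only the relative
depth survives. [folklore] -/
theorem schwarz_band {Φ : ℂ → ℂ} {ρ M q g : ℝ} (hρ : 0 < ρ)
    (hd : DifferentiableOn ℂ Φ (ball 0 ρ)) (hM : MapsTo Φ (ball 0 ρ) (closedBall (Φ 0) M))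
    (hg0 : 0 ≤ g) (hg : g ≤ q * ρ) (hq : q < 1) :
    ‖Φ g - Φ 0‖ ≤ M * q := by
  have hMpos : 0 ≤ M := by
    have h0 := hM (mem_ball_self hρ)
    simpa using h0
  have hglt : g < ρ := by
    calc g ≤ q * ρ := hg
      _ < 1 * ρ := mul_lt_mul_of_pos_right hq hρ
      _ = ρ := one_mul ρ
  have hnorm : ‖((g : ℝ) : ℂ)‖ = g := by
    rw [Complex.norm_real, Real.norm_eq_abs, abs_of_nonneg hg0]
  have hmem : ((g : ℝ) : ℂ) ∈ ball (0 : ℂ) ρ := by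
    rw [mem_ball, dist_zero_right, hnorm]; exact hglt
  have h := Complex.dist_le_div_mul_dist_of_mapsTo_ball hd hM hmem
  rw [dist_eq_norm, dist_zero_right, hnorm] at h
  calc ‖Φ g - Φ 0‖ ≤ M / ρ * g := h
    _ ≤ M / ρ * (q * ρ) := mul_le_mul_of_nonneg_left hg (div_nonneg hMpos hρ.le)
    _ = M * q := by field_simp

/-! ## §2 The run-keyed hypothesis shape: a FROZEN-DOMAIN COMPLEX-VERTEX FAMILY along in-window runs -/

/-- HYPOTHESIS SHAPE (never a fact): **FROZEN-DOMAIN COMPLEX-VERTEX FAMILY** of `β` relative to the reference numbers `b`,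
with relative depth `q`, oscillation `M`, centre defect `η`, on the in-window runs of level `γ₀`.  For every prefix of every
solution of (0.20) staying in `]0, γ₀]` there is an auxiliary function `Φ` of a COMPLEX vertex coupling — analytic on a disc
`|z| < ρ`, the physical coupling `gs k` at relative depth `≤ q·ρ`, oscillation from the centre value `≤ M`, centre value
(the structural zero of (2.13) at vertex coupling 0, up to the small-field mass term) of size `≤ η` — whose value at the
physical point IS `β_{k+1}(prefix) − b_k`.  The supplier builds `Φ` from the record's own (2.13) integral with the small-field
domain FROZEN at `ε/g_k` (print: [I] (2.9), (2.12)–(2.13) pp.266–268; complex-coupling analyticity asserted p.266 for a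
coupling-independent domain; (1.34)–(1.36) of [II] p.9 give the complex activities).  RUN-KEYED (RULE F4): no slot of the
record's history is differentiated or complexified. [cite: Balaban1987RG1, (2.13) p.268] -/
def FrozenVertexFamily (β : HBeta) (b : ℕ → ℝ) (q M η γ₀ : ℝ) : Prop :=
  ∀ (n : ℕ) (gs : ℕ → ℝ), RGEqH n β gs → Step.InInterval γ₀ n gs → ∀ k, k ≤ n →
    ∃ (Φ : ℂ → ℂ) (ρ : ℝ), 0 < ρ ∧ DifferentiableOn ℂ Φ (ball 0 ρ) ∧ MapsTo Φ (ball 0 ρ) (closedBall (Φ 0) M) ∧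
      gs k ≤ q * ρ ∧ ‖Φ 0‖ ≤ η ∧ (((β k (prefixOf gs k) - b k : ℝ)) : ℂ) = Φ ((gs k : ℝ) : ℂ)

/-! ## §3 FAMILY ⟹ the tree's letter `RunConstRemainder` (v9 stub 2″'s first β-conjunct), band `M·q + η` -/

/-- **FROZEN-DOMAIN SCHWARZ ⟹ RUN-WISE CONSTANT REMAINDER** with the band `M·q + η`: k-uniform and history-uniform
because the relative depth `q` is run-independent. [folklore] -/
theorem runConstRemainder_of_frozenVertexFamily {β : HBeta} {b : ℕ → ℝ} {q M η γ₀ : ℝ}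
    (hq : q < 1) (h : FrozenVertexFamily β b q M η γ₀) :
    RunConstRemainder β b (M * q + η) γ₀ := by
  intro n gs hrg hI k hk
  obtain ⟨Φ, ρ, hρ, hd, hM, hdepth, hη, hval⟩ := h n gs hrg hI k hk
  have hg0 : 0 ≤ gs k := (hI k hk).1.le
  have hband := schwarz_band hρ hd hM hg0 hdepth hq
  have hnormβ : |β k (prefixOf gs k) - b k| = ‖Φ ((gs k : ℝ) : ℂ)‖ := by
    rw [← hval, Complex.norm_real, Real.norm_eq_abs]
  rw [hnormβ]
  calc ‖Φ ((gs k : ℝ) : ℂ)‖ = ‖(Φ ((gs k : ℝ) : ℂ) - Φ 0) + Φ 0‖ := by rw [sub_add_cancel]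
    _ ≤ ‖Φ ((gs k : ℝ) : ℂ) - Φ 0‖ + ‖Φ 0‖ := norm_add_le _ _
    _ ≤ M * q + η := add_le_add hband hη

/-! ## §4 BAND BELOW THE ONE-LOOP FLOOR ⟹ the SIGN along runs ⟹ K1⁹'s row (iv) with floor constant 0 -/

/-- If the band lies below the reference floor (`M·q + η ≤ b_k`, the (D1)-lane's one-loop positivity plus the smallness of
`θ.ε₂₉`, `θ.γ`), every `β_{k+1}` read at an in-window run prefix is `≥ 0`. [folklore] -/
theorem beta_nonneg_on_runs_of_band {β : HBeta} {b : ℕ → ℝ} {r γ₀ : ℝ}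
    (h : RunConstRemainder β b r γ₀) (hfloor : ∀ k, r ≤ b k) :
    ∀ (n : ℕ) (gs : ℕ → ℝ), RGEqH n β gs → Step.InInterval γ₀ n gs → ∀ k, k ≤ n → 0 ≤ β k (prefixOf gs k) := by
  intro n gs hrg hI k hk
  have hk' := h n gs hrg hI k hk
  have := (abs_sub_le_iff.mp hk').2
  linarith [hfloor k]

/-- … hence the RUN-WISE PARTIAL-SUM FLOOR of K1⁹'s row (iv) with `M := 0`:
`0 ≤ Σ_{j ∈ [k,n)} β_j(prefix_j)` along every in-window run. [folklore] -/
theorem runwise_partialSum_floor_of_band {β : HBeta} {b : ℕ → ℝ} {r γ₀ : ℝ}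
    (h : RunConstRemainder β b r γ₀) (hfloor : ∀ k, r ≤ b k) :
    ∀ (n : ℕ) (gs : ℕ → ℝ), RGEqH n β gs → Step.InInterval γ₀ n gs →
      ∀ k, k ≤ n → -(0 : ℝ) ≤ ∑ j ∈ Finset.Ico k n, β j (prefixOf gs j) := by
  intro n gs hrg hI k hk
  rw [neg_zero]
  refine Finset.sum_nonneg fun j hj => ?_
  have hjn : j ≤ n := (Finset.mem_Ico.mp hj).2.le
  exact beta_nonneg_on_runs_of_band h hfloor n gs hrg hI j hjn

/-! ## §5 The composition of the line in one statement (what a line on 27364 would export for rows (i)+(iv)) -/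

/-- **THE FROZEN-SCHWARZ ROAD TO ROWS (i)+(iv).**  A frozen-domain complex-vertex family of relative depth `q < 1`,
oscillation `M`, centre defect `η`, relative to reference numbers `b` that dominate the band (`M·q + η ≤ b_k`), gives along
every in-window run of level `γ₀`: the constant-remainder row (i) with `r = M·q + η` AND the partial-sum floor (iv) with
constant `0`. [folklore] -/
theorem rows_i_iv_of_frozenVertexFamily {β : HBeta} {b : ℕ → ℝ} {q M η γ₀ : ℝ}
    (hq : q < 1) (h : FrozenVertexFamily β b q M η γ₀) (hfloor : ∀ k, M * q + η ≤ b k) :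
    RunConstRemainder β b (M * q + η) γ₀ ∧
      ∀ (n : ℕ) (gs : ℕ → ℝ), RGEqH n β gs → Step.InInterval γ₀ n gs →
        ∀ k, k ≤ n → -(0 : ℝ) ≤ ∑ j ∈ Finset.Ico k n, β j (prefixOf gs j) :=
  ⟨runConstRemainder_of_frozenVertexFamily hq h,
    runwise_partialSum_floor_of_band (runConstRemainder_of_frozenVertexFamily hq h) hfloor⟩

/-! ## §6 Non-vacuity and tightness toys -/

/-- TOY (tightness): the linear function `Φ z = (M/ρ)·z` is analytic on the disc, oscillates by `< M` there, vanishes at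
the centre, and REALISES the band `M·q` at the point `q·ρ` — Schwarz's constant cannot be improved. [folklore] -/
theorem schwarz_band_tight {ρ M q : ℝ} (hρ : 0 < ρ) (hM : 0 ≤ M) (hq0 : 0 ≤ q) :
    ‖(fun z : ℂ => ((M / ρ : ℝ) : ℂ) * z) ((q * ρ : ℝ) : ℂ) - (fun z : ℂ => ((M / ρ : ℝ) : ℂ) * z) 0‖ = M * q := by
  simp only [mul_zero, sub_zero, norm_mul, Complex.norm_real, Real.norm_eq_abs]
  rw [abs_of_nonneg (div_nonneg hM hρ.le)]
  simp only [abs_of_nonneg hq0, abs_of_nonneg hρ.le]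
  field_simp

/-- TOY (non-vacuity of the family shape): the constant-in-history β `β k v := b k + c·(v (Fin.last k))` (a remainder LINEAR in
the last run slot with `|c|·γ₀ < M·q`, any `q ∈ ]0,1[`) carries a frozen-vertex family with `η = 0`: take `Φ z := c·z`,
`ρ := gs k / q`. [folklore] -/
theorem frozenVertexFamily_of_linear (b : ℕ → ℝ) {c q M γ₀ : ℝ} (hq0 : 0 < q)
    (hc : |c| * γ₀ < M * q) :
    FrozenVertexFamily (fun k v => b k + c * v (Fin.last k)) b q M 0 γ₀ := by
  intro n gs _hrg hI k hk
  have hgk := hI k hk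
  refine ⟨fun z => (c : ℂ) * z, gs k / q, div_pos hgk.1 hq0, ?_, ?_, ?_, by simp, ?_⟩
  · exact (differentiableOn_const _).mul differentiableOn_id
  · intro z hz
    rw [mem_ball, dist_zero_right] at hz
    show (c : ℂ) * z ∈ closedBall ((c : ℂ) * 0) M
    rw [mem_closedBall, mul_zero, dist_zero_right, norm_mul, Complex.norm_real, Real.norm_eq_abs]
    have hle : |c| * ‖z‖ ≤ M := by
      calc |c| * ‖z‖ ≤ |c| * (gs k / q) := mul_le_mul_of_nonneg_left hz.le (abs_nonneg c)
        _ ≤ |c| * (γ₀ / q) := by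
            apply mul_le_mul_of_nonneg_left _ (abs_nonneg c)
            exact div_le_div_of_nonneg_right hgk.2 hq0.le
        _ = (|c| * γ₀) / q := by ring
        _ ≤ (M * q) / q := div_le_div_of_nonneg_right hc.le hq0.le
        _ = M := by field_simp
    exact hle
  · rw [mul_div_cancel₀ _ hq0.ne']
  · simp [prefixOf]

end

end Summit.QuantumFields.YangMills.Cruxes.EndpointGivenBR13SepCoPH.Idea5g18FrozenSchwarz
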